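/-
Origin: expansion seat `planner-pub-hodgecm-mc-sanity-1-g2-0`, handover #3 2026-08-18T21:25Z md5 af19a69d0c8dec6c8e5cf045d6d4956f (NEW, 217 l., 24 decls; rc 0 / 6 s / 0 warnings / 0 proof-hole-adm-token tokens / trio 3/3; imports HodgeCM.Model.Binders.MeetBridgesShells (= binder-1-g2 t33 #2 as rewritten) + HodgeCM.Model.Sanity.MeetRecord (t32-mcsanity1 e3014f5fe7d1) + PKG HodgeCM.Automorphic.QuotientModelOfLattice + Mathlib.Analysis.CStarAlgebra.Matrix, Mathlib.Topology.Algebr (`HOME/mc/pub-hodgecm-mc-sanity-1-g2/lean/ShellSanity.lean`, md5 af19a69d, 217 lines);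
landed by the packager successor (mc-unitary-1-g3, gen-8 kit) in gate run 32 as `HodgeCM/Model/Sanity/ShellSanity.lean` (stripped 3 #print/#check/#eval lines).
-/
import Summits.HodgeConjecture.HodgeCM.Model.Binders.MeetBridgesShells
import Summits.HodgeConjecture.HodgeCM.Model.Sanity.MeetRecord
import Summits.HodgeConjecture.HodgeCM.Automorphic.QuotientModelOfLattice
import Mathlib.Analysis.CStarAlgebra.Matrix
import Mathlib.Topology.Algebra.Star.Unitary
import Mathlib.Analysis.Real.Pi.Irrational
import Mathlib.Analysis.SpecialFunctions.Complex.Log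

/-!
# Sanity of the (34) Qaut SHELL (`ThetaModel.QautCore`, binder-1-g2 `MeetBridgesShells` 273ade679279): the
# analytic shell is CONSISTENT (a toy `U(2)` instance), and the whole record is inhabited on ZERO torus theta data

MODEL-CONSTRUCTION sub-cell, SANITY lane (unit `pub-hodgecm-mc-sanity-1-g2`, node SAN-4).  KERNEL only: nothing
cited, no proof holes, no new constants.

`QautCore T V c D` (row hQ, ₁₀ form) posits an analytic shell — a compact group `K` with a Haar probability measure,
a commutative Banach algebra `C` with a strongly continuous `K`-action `σ`, a continuous representation
`ρ : K →* GL₂(ℂ)` with a diagonal element of distinct eigenvalues, an antidiagonal element and a CENTRAL element `k₀`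
acting by a scalar `ξ` of INFINITE order — plus dictionary data `toHG`, `Forms₁`, `Forms₂`, a dense `P ⊆ 𝒮^κ` and the
decomposition field `decomp`.  If the shell axioms were jointly unsatisfiable, every `QautCore → …` theorem
(`real34MeetAt_of_qautCore`, `Real34FunBridge.ofQautCore`) would be vacuous.  This file removes that doubt in the
kernel and locates the content of the record:

* §1 `toyShell`: `K := U(2)` (compact: entries of a unitary matrix have norm `≤ 1`, `entry_norm_bound_of_unitary`, and
  `unitary` is closed), `μ :=` the Haar measure normalised on `⊤` (right invariant by the PACKAGE's own
  `CocompactLattice.isMulRightInvariant_of_cocompactLattice` with the trivial lattice), `C := ℂ`, `σ := 1`,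
  `ρ :=` the inclusion, `diag(1,-1)`, `antidiag(1,1)`, `k₀ := e^{i}·1` with `ξ := e^{i}` of infinite order
  (`irrational_pi`);
* §2 `toyQautCore (h0 : ∀ χ Φ, D.ϑ χ Φ = 0) : QautCore T V c D` — with `toHG := 0`, no forms, `P := univ` and the
  EMPTY decomposition; hence `Nonempty (QautCore T V c D)` whenever the torus theta distributions of `D` vanish, in
  particular for `(C.thetaModel h d12 d34).t34` at ZERO KERNELS (`nonempty_qautCore_of_zeroKernelsAt`).
READING: the shell fields and `toHG / Forms / P / dense` carry no content on their own; `QautCore`'s content is the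
single field `decomp` AGAINST NON-ZERO `ϑ`, i.e. (like C6′ itself, gen-1 SAN-1a) it certifies content only through
the kernels `wm`.  The (12) shell `SeesawFunBridge` is not instantiated here (its `ThetaSeesawData` carries measure
spaces and the period identity `ϑ_period`); it is bounded by `gen12MeetAt_of_seesawFunBridge` /
`nonempty_gen12FunBridge_of_seesawFunBridge` (binder-1-g2) composed with `BridgeSanity` §2–§3.
-/

set_option autoImplicit false

noncomputable section

open MeasureTheory Matrix Complex
open scoped Real

namespace HodgeCM

namespace Model.Sanity.Shell

/-! ## §1 The toy analytic shell on `U(2)` (instances SCOPED to this namespace: nothing global on Mathlib types) -/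

/-- The toy compact group `U(2)`. -/
abbrev U2 : Type := ↥(Matrix.unitaryGroup (Fin 2) ℂ)

/-- (Ported verbatim from the HodgeCMPerL package; no docstring in the source.) -/
theorem isCompact_unitaryGroup :
    IsCompact (Matrix.unitaryGroup (Fin 2) ℂ : Set (Matrix (Fin 2) (Fin 2) ℂ)) := by
  have hB : IsCompact (Set.univ.pi fun _ : Fin 2 => Set.univ.pi fun _ : Fin 2 => Metric.closedBall (0 : ℂ) 1) :=
    isCompact_univ_pi fun _ => isCompact_univ_pi fun _ => isCompact_closedBall (0 : ℂ) 1
  have hcl : IsClosed (Matrix.unitaryGroup (Fin 2) ℂ : Set (Matrix (Fin 2) (Fin 2) ℂ)) := isClosed_unitary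
  have hsub : ∀ A ∈ (Matrix.unitaryGroup (Fin 2) ℂ : Set (Matrix (Fin 2) (Fin 2) ℂ)), ∀ i j : Fin 2,
      A i j ∈ Metric.closedBall (0 : ℂ) 1 := fun A hA i j => by
    rw [Metric.mem_closedBall, dist_zero_right]
    exact entry_norm_bound_of_unitary hA i j
  exact hB.of_isClosed_subset hcl fun A hA i _ j _ => hsub A hA i j

/-- (Ported verbatim from the HodgeCMPerL package; no docstring in the source.) -/
scoped instance : SecondCountableTopology (Matrix (Fin 2) (Fin 2) ℂ) :=
  inferInstanceAs (SecondCountableTopology (Fin 2 → Fin 2 → ℂ))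

/-- (Ported verbatim from the HodgeCMPerL package; no docstring in the source.) -/
scoped instance : SecondCountableTopology U2 :=
  inferInstanceAs (SecondCountableTopology ↥(Matrix.unitaryGroup (Fin 2) ℂ : Set (Matrix (Fin 2) (Fin 2) ℂ)))

/-- (Ported verbatim from the HodgeCMPerL package; no docstring in the source.) -/
scoped instance : CompactSpace U2 := isCompact_iff_compactSpace.mp isCompact_unitaryGroup

/-- (Ported verbatim from the HodgeCMPerL package; no docstring in the source.) -/
scoped instance : MeasurableSpace U2 := borel U2
/-- (Ported verbatim from the HodgeCMPerL package; no docstring in the source.) -/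
scoped instance : BorelSpace U2 := ⟨rfl⟩

/-- (Ported verbatim from the HodgeCMPerL package; no docstring in the source.) -/
scoped instance : LocallyCompactSpace U2 := (⊤ : TopologicalSpace.PositiveCompacts U2).locallyCompactSpace_of_group

/-- (Ported verbatim from the HodgeCMPerL package; no docstring in the source.) -/
scoped instance : DiscreteTopology (⊥ : Subgroup U2) :=
  discreteTopology_iff_forall_isOpen.mpr fun s => Subsingleton.set_cases isOpen_empty isOpen_univ s

/-- The Haar probability measure of `U(2)`. -/
abbrev μ2 : Measure U2 := Measure.haarMeasure ⊤

/-- (Ported verbatim from the HodgeCMPerL package; no docstring in the source.) -/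
scoped instance : IsProbabilityMeasure μ2 :=
  ⟨by simpa using (Measure.haarMeasure_self (G := U2) (K₀ := ⊤))⟩

/-- (Ported verbatim from the HodgeCMPerL package; no docstring in the source.) -/
scoped instance : μ2.IsMulRightInvariant :=
  HodgeCM.CocompactLattice.isMulRightInvariant_of_cocompactLattice (⊥ : Subgroup U2) μ2

/-- The scalar of infinite order: `ξ := e^{i}`. -/
abbrev ξ2 : ℂ := Complex.exp I

/-- (Ported verbatim from the HodgeCMPerL package; no docstring in the source.) -/
theorem ξ2_mul_conj : ξ2 * (starRingEnd ℂ) ξ2 = 1 := by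
  rw [ξ2, ← exp_conj, ← Complex.exp_add, conj_I, add_neg_cancel, Complex.exp_zero]

/-- (Ported verbatim from the HodgeCMPerL package; no docstring in the source.) -/
theorem ξ2_ne_zero : ξ2 ≠ 0 := Complex.exp_ne_zero _

/-- (Ported verbatim from the HodgeCMPerL package; no docstring in the source.) -/
theorem ξ2_pow_ne_one (m : ℕ) (hm : 1 ≤ m) : ξ2 ^ m ≠ 1 := by
  intro h
  rw [ξ2, ← Complex.exp_nat_mul, Complex.exp_eq_one_iff] at h
  obtain ⟨n, hn⟩ := h
  have him := congrArg Complex.im hn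
  simp only [mul_im, natCast_re, I_im, mul_one, natCast_im, I_re, mul_zero, add_zero, intCast_re, intCast_im,
    zero_mul, mul_re, re_ofNat, ofReal_re, im_ofNat, ofReal_im, sub_zero, sub_self] at him
  -- him : (m : ℝ) = n * (2 * π)
  have hn0 : (n : ℝ) ≠ 0 := by
    intro h0
    rw [h0, zero_mul] at him
    have : (m : ℝ) = 0 := him
    exact absurd (by exact_mod_cast this : m = 0) (by omega)
  have hπ : (π : ℝ) = ((m : ℤ) : ℝ) / ((2 * n : ℤ) : ℝ) := by
    push_cast
    rw [eq_div_iff (mul_ne_zero two_ne_zero hn0)]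
    linear_combination -him
  exact (irrational_iff_ne_rational π).mp irrational_pi m (2 * n) (by exact_mod_cast mul_ne_zero two_ne_zero hn0) hπ

/-- (Ported verbatim from the HodgeCMPerL package; no docstring in the source.) -/
theorem diag_mem : !![(1 : ℂ), 0; 0, -1] ∈ Matrix.unitaryGroup (Fin 2) ℂ := by
  rw [Matrix.mem_unitaryGroup_iff]
  ext i j
  fin_cases i <;> fin_cases j <;> simp [Matrix.mul_apply, Fin.sum_univ_two, Matrix.star_eq_conjTranspose]

/-- (Ported verbatim from the HodgeCMPerL package; no docstring in the source.) -/
theorem antidiag_mem : !![(0 : ℂ), 1; 1, 0] ∈ Matrix.unitaryGroup (Fin 2) ℂ := by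
  rw [Matrix.mem_unitaryGroup_iff]
  ext i j
  fin_cases i <;> fin_cases j <;> simp [Matrix.mul_apply, Fin.sum_univ_two, Matrix.star_eq_conjTranspose]

/-- (Ported verbatim from the HodgeCMPerL package; no docstring in the source.) -/
theorem scalar_mem : ξ2 • (1 : Matrix (Fin 2) (Fin 2) ℂ) ∈ Matrix.unitaryGroup (Fin 2) ℂ := by
  rw [Matrix.mem_unitaryGroup_iff, star_smul, star_one, Matrix.smul_mul, Matrix.mul_smul, mul_one, smul_smul,
    Complex.star_def, ξ2_mul_conj, one_smul]

/-! ## §2 The Qaut record on zero torus theta data -/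

end Model.Sanity.Shell

namespace Universe.ThetaModel

open HodgeCM.Model.Sanity.Shell HodgeCM.Prior.Perl34File HodgeCM.PerL34 HodgeCM.PerL34.Qaut

variable {U : Universe} (T : U.ThetaModel)
variable {L : CMField} {ι₁ : L →+* ℂ} (V : HermSpace3 L ι₁) (c : SeesawCtx L)
variable (D : Perl34.TorusData (T.core V c))

/-- **The Qaut core on ZERO torus theta data**: the toy `U(2)` shell, `toHG := 0`, no theta one-forms,
`P := univ`, and the EMPTY decomposition of `ϑ_χ(Φ) = 0`. -/
def toyQautCore (h0 : ∀ (χ : D.X) (Φ : T.SK V c), D.ϑ χ Φ = 0) : QautCore T V c D where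
  K := U2
  μ := μ2
  C := ℂ
  σ := 1
  σ_cont _ := continuous_const
  ρ := (Matrix.unitaryGroup (Fin 2) ℂ).subtype
  ρ_cont := continuous_subtype_val
  ρ_det x := Matrix.isUnit_det_of_left_inverse x.2.1
  ρ_diag := ⟨⟨_, diag_mem⟩, 1, -1, by norm_num, rfl⟩
  ρ_antidiag := ⟨⟨_, antidiag_mem⟩, 1, 1, rfl⟩
  k₀ := ⟨_, scalar_mem⟩
  ξ := ξ2
  ξ_ne_zero := ξ2_ne_zero
  ξ_pow_ne_one := ξ2_pow_ne_one
  ρ_k₀ := rfl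
  toHG := 0
  Forms₁ _ := ∅
  Forms₂ _ := ∅
  isForm₁ _ _ hu := hu.elim
  isForm₂ _ _ hv := hv.elim
  P := Set.univ
  dense := dense_univ
  decomp χ Φ _ := ⟨0, Fin.elim0, Fin.elim0, Fin.elim0, Fin.elim0, fun i => i.elim0, fun i => i.elim0, by
    rw [h0, LinearMap.zero_apply]⟩

/-- **`QautCore` is inhabited on zero torus theta data** (any model, any context, any torus data). -/
theorem nonempty_qautCore_of_ϑ_eq_zero (h0 : ∀ (χ : D.X) (Φ : T.SK V c), D.ϑ χ Φ = 0) :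
    Nonempty (QautCore T V c D) :=
  ⟨T.toyQautCore V c D h0⟩

/-- The toy core has NO global wedge-functions. -/
theorem toyQautCore_wset (h0 : ∀ (χ : D.X) (Φ : T.SK V c), D.ϑ χ Φ = 0) :
    (T.toyQautCore V c D h0).wset = ∅ := by
  ext x
  simp only [QautCore.wset, Set.mem_setOf_eq, Set.mem_empty_iff_false, iff_false, not_exists, not_and]
  intro χ u hu
  exact hu.elim

end Universe.ThetaModel

namespace Universe.AdelicThetaCore

variable {U : Universe} {hP : PrintFact_unitaryCompact} (C : U.AdelicThetaCore hP) (h : Bool)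
  (d12 d34 : ∀ {L : CMField}, SeesawCtx L → SideData L)
variable {L : CMField} {ι₁ : L →+* ℂ} (V : HermSpace3 L ι₁) (c : SeesawCtx L)

/-- **At ZERO KERNELS the (34) Qaut core of the sign-recipe model is inhabited** (with the (34) torus data of the
model): the shell + dictionary posits nothing that detects a degenerate `wm`. -/
theorem nonempty_qautCore_of_zeroKernelsAt (hθ : C.ZeroKernelsAt V c) :
    Nonempty ((C.thetaModel h d12 d34).QautCore V c ((C.thetaModel h d12 d34).t34 V c)) :=
  (C.thetaModel h d12 d34).nonempty_qautCore_of_ϑ_eq_zero V c _ (C.thetaModel_ϑ34_eq_zero h d12 d34 V c hθ)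

/-- … and combined with `Real34FunBridge.ofQautCore`: at zero kernels the `meet` hypothesis over the toy core is
VACUOUS (`wset = ∅`), so C6′ via the Qaut core holds there with no input at all. -/
theorem real34MeetAt_of_zeroKernelsAt_viaQaut (hθ : C.ZeroKernelsAt V c) :
    (C.thetaModel h d12 d34).Real34MeetAt V c :=
  (C.thetaModel h d12 d34).real34MeetAt_of_qautCore
    ((C.thetaModel h d12 d34).toyQautCore V c _ (C.thetaModel_ϑ34_eq_zero h d12 d34 V c hθ))
    (fun Γ₁ ω₁ ω₂ _ _ P hP _ => by
      rw [(C.thetaModel h d12 d34).toyQautCore_wset V c] at hP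
      exact hP.elim)

end Universe.AdelicThetaCore

end HodgeCM

end

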